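import Literature.MathematicalPhysics.QuantumFieldTheory.Balaban1983to89.B3Taylor310Remainder

/-!
# `Balaban1983to89.B3Ineq313Pointwise` — T. Bałaban, *(Higgs)₂,₃ quantum fields in a finite volume. III. Renormalization*,
Commun. Math. Phys. **88** (1983) 411–445 [Balaban1983Higgs3], p. 436 [PDF 26]: the estimate **(3.13)/(3.14)** of the generalized
expression **(3.12)** (the second term of (3.11): the self-energy bracket of (3.9) acting on the Taylor remainder of the leg `φ′`),
PROVED in POINTWISE form on the torus calculus from (2.10)-type kernel bounds

statement-level skeleton of published theorems with citation tags; proofs where landed; nothing here is a claim about the Yang–Mills mass gap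

PDF held: `paper:balaban1983-higgs-2-3-quantum-fields-finite-volume` (journal page = PDF page + 410).  Read: p. 436 [PDF 26] on the ×2
render `run/shared/lean/pub/pub-balaban/b2b-balaban-ref1/pages/1983-cmp88-higgs23-III/1983-cmp88-higgs23-III-p026-x2.png`; p. 426
[PDF 16] ((2.10)).

CITATION HEADER (lean-in-tree rule).  Part of the lit-balaban TYPED SKELETON (HOME `run/shared/lean/pub/lit-balaban/`), PHASE 2, seat p20
generation 2; companion of `B3Taylor310Remainder` (same seat: the remainder `remFwd` of (3.10) and its Hölder bound `norm_remFwd_le`).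
WHAT IS REPRODUCED: row **B3.Eq3.11-3.17** of `HOME/lit-balaban-r15/ROWS-B3.md` (fold owner r15), sub-displays (3.12)–(3.14)
(*"(3.12)–(3.14) estimates … not typed"* in the cell before this file).

THE PRINTED TEXT (verbatim, p. 436).  After (3.11): *"The second expression above already has the right form because the factor
|x − x′|^{1+α} adds to the degree of the graph the number 1 + α, thus the degree of the expression is equal to −d + 3 + α now. The
operator acting on the leg φ′ is a differentiation of the order 1 + α, so we will represent graphically this expression by the generalized
graph (3.12). To make the above statements about the degree quite clear let us show how this expression will be estimated. We localize
additionally the vertices in cubes Δ(v), Δ(v′), |Δ(v)| = |Δ(v′)| = (L^{j₁}η)^d, j₁ = min{j, j′}, and we have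
(the expression (3.12)) ≦ O(1) Σ_{Δ(v),Δ(v′)} sup_{x∈Δ(v)} |φ(x)| (L^{j₁}η)^{2d} (L^jη)^{−d} exp[−δ₀(L^jη)^{−1}dist(Δ(v),Δ(v′))]
(L^{j′}η)^{−d+2} exp[−δ₀(L^{j′}η)^{−1}dist(Δ(v),Δ(v′))] · (L^{j₁}η)^{1+α} sup_{x∈Δ(v),x′∈Δ(v′)} sup_{y∈Γ_{x,x′},μ}
|(∂^η_μφ′)(y) − (∂^η_μφ′)(x)| / |y − x|^α. (3.13)  We can estimate the factor ((L^{j₁}η)^{−1}dist(Δ(v),Δ(v′)))^{1+α} by O(1) using half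
of the exponential factor with index j₁."*

WHAT IS TYPED / PROVED, and how.  `term312` = the expression (3.12) (the second term of (3.11) without its sign, the remainder `R = remFwd`
of `B3Taylor310Remainder.eq311_taylor`; `eq311_split`: (3.9) = −[first term] − `term312`).  **`abs_term312_le`** = (3.13) BEFORE the
localization into cubes, PROVED: if the twice-differentiated propagator kernel obeys the (2.10)-type bound
`|(∂^η_μG_{(j)}(0)∂^{η*}_μ)(x,x′)| ≤ C₁(L^jη)^{−d}e^{−δ(L^jη)^{−1}|x−x′|}` (every μ), the second propagator
`|G_{(j′)}(x,x′)| ≤ C₂(L^{j′}η)^{−d+2}e^{−δ(L^{j′}η)^{−1}|x−x′|}`, the localization functions `|g|, |g′| ≤ 1`, the charge matrix `‖qw‖ ≤ Q‖w‖`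
and the leg `φ′` the Hölder hypothesis `B3Taylor310Remainder.HolderDeriv η⁻¹ α H φ′` (`0 ≤ α ≤ 1`), then
`|(3.12)| ≤ 2dC₁C₂Q²H(2/δ + 8/δ²)·(L^{j₁}η)^{1+α}·Σ_{x,x′}η^{2d}‖φ(x)‖(L^jη)^{−d}e^{−½δ(L^jη)^{−1}|x−x′|}(L^{j′}η)^{−d+2}e^{−½δ(L^{j′}η)^{−1}|x−x′|}`
with `L^{j₁}η = min(L^jη, L^{j′}η)` (written `m·m^α`, `m = min s s′`) — the printed factors of (3.13)/(3.14) with `δ₀ = ½δ`, the volume sum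
`Σ_{x,x′}η^{2d}` not yet resolved into `Σ_{Δ(v),Δ(v′)}(L^{j₁}η)^{2d} sup` (that localization is row B3.Eq2.13-2.14 / (2.15), seat p19).
The two printed mechanisms are kernel lemmas: *"using half of the exponential factor with index j₁"* = `exp_split_half` + the elementary
`u·u^α·e^{−au} ≤ (1/a + 2/a²)` rescaled to `(L^{j₁}η)^{1+α}` (`mul_rpow_mul_exp_le_scale`); the distance is `|x − x′| = η·Site.tdist x x′`
(`ℓ¹`, lattice steps; `Setup` DIVERGENCE F2).  The kernel bounds are HYPOTHESES here (rows B3.Eq2.10–2.12: consequences of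
[Balaban1982Higgs1] Props. 2.1/2.3, not proved in this file).  Unit `lit-balaban-p20` (literature-prover-lit-balaban-p20-g2-0), 2026-08-21.
-/

open scoped BigOperators RealInnerProductSpace

namespace Literature.MathematicalPhysics.QuantumFieldTheory.Balaban1983to89.B3Ineq313Pointwise

open LatticeFieldCalculus B3Sect3ScalarSelfEnergy B3Taylor310Remainder

noncomputable section

/-! ## 1. Elementary: `u·u^α·e^{−au} ≤ 1/a + 2/a²` and "half of the exponential factor with index j₁" -/

section Elementary

/-- kernel: `t·t^α ≤ t + t²` for `t ≥ 0`, `0 ≤ α ≤ 1`. [folklore] -/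
private theorem mul_rpow_le_add_sq {t α : ℝ} (ht : 0 ≤ t) (hα0 : 0 ≤ α) (hα1 : α ≤ 1) : t * t ^ α ≤ t + t ^ 2 := by
  rcases le_total t 1 with h1 | h1
  · have h2 : t ^ α ≤ 1 := Real.rpow_le_one ht h1 hα0
    nlinarith [sq_nonneg t]
  · have h2 : t ^ α ≤ t := by
      calc t ^ α ≤ t ^ (1 : ℝ) := Real.rpow_le_rpow_of_exponent_le h1 hα1
        _ = t := Real.rpow_one t
    nlinarith

/-- kernel: `t·e^{−at} ≤ 1/a` for `t ≥ 0`, `a > 0`. [folklore] -/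
private theorem mul_exp_neg_le {a : ℝ} (ha : 0 < a) (t : ℝ) : t * Real.exp (-(a * t)) ≤ 1 / a := by
  have h1 : a * t + 1 ≤ Real.exp (a * t) := Real.add_one_le_exp _
  have h2 : Real.exp (a * t) * Real.exp (-(a * t)) = 1 := by rw [← Real.exp_add, add_neg_cancel, Real.exp_zero]
  have h3 : 0 < Real.exp (-(a * t)) := Real.exp_pos _
  rw [le_div_iff₀ ha]
  nlinarith [mul_le_mul_of_nonneg_right h1 h3.le]

/-- kernel: `t²·e^{−at} ≤ 2/a²` for `t ≥ 0`, `a > 0`. [folklore] -/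
private theorem sq_mul_exp_neg_le {a t : ℝ} (ha : 0 < a) (ht : 0 ≤ t) : t ^ 2 * Real.exp (-(a * t)) ≤ 2 / a ^ 2 := by
  have h1 : 1 + a * t + (a * t) ^ 2 / 2 ≤ Real.exp (a * t) := Real.quadratic_le_exp_of_nonneg (by positivity)
  have h2 : Real.exp (a * t) * Real.exp (-(a * t)) = 1 := by rw [← Real.exp_add, add_neg_cancel, Real.exp_zero]
  have h3 : 0 < Real.exp (-(a * t)) := Real.exp_pos _
  rw [le_div_iff₀ (by positivity)]
  nlinarith [mul_le_mul_of_nonneg_right h1 h3.le, mul_nonneg ha.le ht]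

/-- kernel: `u·u^α·e^{−au} ≤ 1/a + 2/a²` (`u ≥ 0`, `0 ≤ α ≤ 1`, `a > 0`). [folklore] -/
private theorem mul_rpow_mul_exp_le {u α a : ℝ} (hu : 0 ≤ u) (hα0 : 0 ≤ α) (hα1 : α ≤ 1) (ha : 0 < a) :
    u * u ^ α * Real.exp (-(a * u)) ≤ 1 / a + 2 / a ^ 2 := by
  calc u * u ^ α * Real.exp (-(a * u)) ≤ (u + u ^ 2) * Real.exp (-(a * u)) :=
        mul_le_mul_of_nonneg_right (mul_rpow_le_add_sq hu hα0 hα1) (Real.exp_pos _).le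
    _ = u * Real.exp (-(a * u)) + u ^ 2 * Real.exp (-(a * u)) := by ring
    _ ≤ 1 / a + 2 / a ^ 2 := add_le_add (mul_exp_neg_le ha u) (sq_mul_exp_neg_le ha hu)

/-- p. 436 [PDF 26]: *"We can estimate the factor ((L^{j₁}η)^{−1}dist(Δ(v),Δ(v′)))^{1+α} by O(1) using half of the exponential factor
with index j₁"* — the rescaled elementary bound `u·u^α·e^{−a u/s} ≤ (1/a + 2/a²)·s·s^α` (`u ≥ 0`, `s > 0`). [cite: Balaban1983Higgs3, (3.13) p.436] -/
theorem mul_rpow_mul_exp_le_scale {u α a s : ℝ} (hu : 0 ≤ u) (hα0 : 0 ≤ α) (hα1 : α ≤ 1) (ha : 0 < a) (hs : 0 < s) :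
    u * u ^ α * Real.exp (-(a * s⁻¹ * u)) ≤ (1 / a + 2 / a ^ 2) * (s * s ^ α) := by
  have ht : 0 ≤ s⁻¹ * u := mul_nonneg (inv_nonneg.mpr hs.le) hu
  have key := mul_rpow_mul_exp_le ht hα0 hα1 ha
  have hu' : u = s * (s⁻¹ * u) := by rw [← mul_assoc, mul_inv_cancel₀ hs.ne', one_mul]
  have hpow : u ^ α = s ^ α * (s⁻¹ * u) ^ α := by
    rw [← Real.mul_rpow hs.le ht, ← hu']
  calc u * u ^ α * Real.exp (-(a * s⁻¹ * u))
      = (s * s ^ α) * ((s⁻¹ * u) * (s⁻¹ * u) ^ α * Real.exp (-(a * (s⁻¹ * u)))) := by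
        rw [hpow, mul_assoc a]; nth_rw 1 [hu']; ring
    _ ≤ (s * s ^ α) * (1 / a + 2 / a ^ 2) := mul_le_mul_of_nonneg_left key (by positivity)
    _ = (1 / a + 2 / a ^ 2) * (s * s ^ α) := mul_comm _ _

/-- p. 436 [PDF 26], *"using half of the exponential factor with index j₁"*, `j₁ = min{j, j′}`: `e^{−δu/s}e^{−δu/s′} ≤
e^{−½δu/min(s,s′)}·e^{−½δu/s}e^{−½δu/s′}` (`u ≥ 0`). [cite: Balaban1983Higgs3, (3.13) p.436] -/
theorem exp_split_half {δ s s' u : ℝ} (hδ : 0 < δ) (hs : 0 < s) (hs' : 0 < s') (hu : 0 ≤ u) :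
    Real.exp (-(δ * s⁻¹ * u)) * Real.exp (-(δ * s'⁻¹ * u)) ≤
      Real.exp (-(δ / 2 * (min s s')⁻¹ * u)) * (Real.exp (-(δ / 2 * s⁻¹ * u)) * Real.exp (-(δ / 2 * s'⁻¹ * u))) := by
  have hm : (min s s')⁻¹ ≤ s⁻¹ + s'⁻¹ := by
    rcases le_total s s' with h | h
    · rw [min_eq_left h]; linarith [inv_nonneg.mpr hs'.le]
    · rw [min_eq_right h]; linarith [inv_nonneg.mpr hs.le]
  have key : δ / 2 * (min s s')⁻¹ * u ≤ δ / 2 * s⁻¹ * u + δ / 2 * s'⁻¹ * u := by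
    calc δ / 2 * (min s s')⁻¹ * u = (δ / 2 * u) * (min s s')⁻¹ := by ring
      _ ≤ (δ / 2 * u) * (s⁻¹ + s'⁻¹) := mul_le_mul_of_nonneg_left hm (by positivity)
      _ = δ / 2 * s⁻¹ * u + δ / 2 * s'⁻¹ * u := by ring
  rw [← Real.exp_add, ← Real.exp_add, ← Real.exp_add, Real.exp_le_exp]
  linarith

/-- kernel: the two mechanisms combined — `e^{−δu/s}e^{−δu/s′}·u·u^α ≤ (2/δ + 8/δ²)·m·m^α·e^{−½δu/s}e^{−½δu/s′}`, `m = min(s,s′)`.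
[cite: Balaban1983Higgs3, (3.13) p.436] -/
theorem exp_mul_weight_le {δ s s' u α : ℝ} (hδ : 0 < δ) (hs : 0 < s) (hs' : 0 < s') (hu : 0 ≤ u) (hα0 : 0 ≤ α) (hα1 : α ≤ 1) :
    Real.exp (-(δ * s⁻¹ * u)) * Real.exp (-(δ * s'⁻¹ * u)) * (u * u ^ α) ≤
      (2 / δ + 8 / δ ^ 2) * (min s s' * (min s s') ^ α) *
        (Real.exp (-(δ / 2 * s⁻¹ * u)) * Real.exp (-(δ / 2 * s'⁻¹ * u))) := by
  have hm : 0 < min s s' := lt_min hs hs'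
  have h1 := exp_split_half hδ hs hs' hu
  have h2 := mul_rpow_mul_exp_le_scale hu hα0 hα1 (half_pos hδ) hm
  have hconst : 1 / (δ / 2) + 2 / (δ / 2) ^ 2 = 2 / δ + 8 / δ ^ 2 := by
    field_simp; ring
  rw [hconst] at h2
  have huu : 0 ≤ u * u ^ α := mul_nonneg hu (Real.rpow_nonneg hu _)
  calc Real.exp (-(δ * s⁻¹ * u)) * Real.exp (-(δ * s'⁻¹ * u)) * (u * u ^ α)
      ≤ Real.exp (-(δ / 2 * (min s s')⁻¹ * u)) * (Real.exp (-(δ / 2 * s⁻¹ * u)) * Real.exp (-(δ / 2 * s'⁻¹ * u)))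
          * (u * u ^ α) := mul_le_mul_of_nonneg_right h1 huu
    _ = (u * u ^ α * Real.exp (-(δ / 2 * (min s s')⁻¹ * u)))
          * (Real.exp (-(δ / 2 * s⁻¹ * u)) * Real.exp (-(δ / 2 * s'⁻¹ * u))) := by ring
    _ ≤ ((2 / δ + 8 / δ ^ 2) * (min s s' * (min s s') ^ α))
          * (Real.exp (-(δ / 2 * s⁻¹ * u)) * Real.exp (-(δ / 2 * s'⁻¹ * u))) :=
        mul_le_mul_of_nonneg_right h2 (by positivity)

end Elementary

/-! ## 2. The expression (3.12) and its pointwise estimate (3.13)/(3.14) -/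

section Ineq313

variable {P : Params} {j : ℕ} {W : Type*} [NormedAddCommGroup W] [InnerProductSpace ℝ W]

/-- **(3.12)** p. 436 [PDF 26]: the generalized expression of degree `−d + 3 + α` — the second term of (3.11) without its sign: the bracket
`Σ_μ q(∂^η_μG_{(j)}(0)∂^{η*}_μ)(x,x′)q g(x)G_{(j′)}(x,x′)g′(x′)` of (3.9) paired with `φ(x)` and the Taylor remainder of the leg `φ′` along
`Γ_{x,x′}` (`B3Taylor310Remainder.remFwd`, the forward-derivative reading used by `eq311`). [cite: Balaban1983Higgs3, (3.12) p.436] -/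
def term312 (η : ℝ) (q : W →ₗ[ℝ] W) (Gj Gj' : Kernel P j) (g g' : SiteField P j ℝ) (φ φ' : SiteField P j W) : ℝ :=
  ∑ x : Site P j, ∑ x' : Site P j, η ^ (2 * P.d) *
    (coeff39 η Gj Gj' g g' x x' * ⟪φ x, q (q (remFwd η⁻¹ φ' x x'))⟫)

/-- (3.11) read as "(3.9) = −[first term] − (3.12)" (`B3Taylor310Remainder.eq311_taylor` with the second term named).
[cite: Balaban1983Higgs3, (3.11) p.436] -/
theorem eq311_split (η : ℝ) (hη : η ≠ 0) (q : W →ₗ[ℝ] W) (Gj Gj' : Kernel P j) (g g' : SiteField P j ℝ)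
    (φ φ' : SiteField P j W) :
    expr39 η q Gj Gj' g g' φ φ' =
      -(∑ μ : Fin P.d, ∑ x : Site P j, η ^ P.d *
          ((∑ x' : Site P j, η ^ P.d * (coeff39 η Gj Gj' g g' x x' * disp η⁻¹ x x' μ)) *
            ⟪φ x, q (q (pdiff η⁻¹ μ φ' x))⟫)) -
        term312 η q Gj Gj' g g' φ φ' :=
  eq311_taylor η hη q Gj Gj' g g' φ φ'

/-- kernel: the bracket of (3.9) under the (2.10)-type kernel bounds: `|c(x,x′)| ≤ dC₁s^{−d}e^{−δu/s}·C₂s′^{2−d}e^{−δu/s′}`, `u = |x − x′|`,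
`|g|, |g′| ≤ 1`. [cite: Balaban1983Higgs3, (3.13) p.436] -/
theorem abs_coeff39_le {η C₁ C₂ δ s s' : ℝ} {Gj Gj' : Kernel P j} {g g' : SiteField P j ℝ}
    (hg : ∀ x, |g x| ≤ 1) (hg' : ∀ x, |g' x| ≤ 1)
    (hGj : ∀ (μ : Fin P.d) (x x' : Site P j),
      |dKernel η⁻¹ μ Gj x x'| ≤ C₁ * s ^ (-(P.d : ℝ)) * Real.exp (-(δ * s⁻¹ * (η * Site.tdist x x'))))
    (hGj' : ∀ x x' : Site P j,
      |Gj' x x'| ≤ C₂ * s' ^ (2 - (P.d : ℝ)) * Real.exp (-(δ * s'⁻¹ * (η * Site.tdist x x'))))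
    (x x' : Site P j) :
    |coeff39 η Gj Gj' g g' x x'| ≤
      (P.d * (C₁ * s ^ (-(P.d : ℝ)) * Real.exp (-(δ * s⁻¹ * (η * Site.tdist x x'))))) *
        (C₂ * s' ^ (2 - (P.d : ℝ)) * Real.exp (-(δ * s'⁻¹ * (η * Site.tdist x x')))) := by
  have hsum : |∑ μ : Fin P.d, dKernel η⁻¹ μ Gj x x'|
      ≤ P.d * (C₁ * s ^ (-(P.d : ℝ)) * Real.exp (-(δ * s⁻¹ * (η * Site.tdist x x')))) := by
    calc |∑ μ : Fin P.d, dKernel η⁻¹ μ Gj x x'| ≤ ∑ μ : Fin P.d, |dKernel η⁻¹ μ Gj x x'| := Finset.abs_sum_le_sum_abs _ _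
      _ ≤ ∑ _μ : Fin P.d, C₁ * s ^ (-(P.d : ℝ)) * Real.exp (-(δ * s⁻¹ * (η * Site.tdist x x'))) :=
          Finset.sum_le_sum fun μ _ => hGj μ x x'
      _ = P.d * (C₁ * s ^ (-(P.d : ℝ)) * Real.exp (-(δ * s⁻¹ * (η * Site.tdist x x')))) := by
          rw [Finset.sum_const, Finset.card_univ, Fintype.card_fin, nsmul_eq_mul]
  have hA : 0 ≤ (P.d : ℝ) * (C₁ * s ^ (-(P.d : ℝ)) * Real.exp (-(δ * s⁻¹ * (η * Site.tdist x x')))) :=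
    (abs_nonneg _).trans hsum
  have hB : 0 ≤ C₂ * s' ^ (2 - (P.d : ℝ)) * Real.exp (-(δ * s'⁻¹ * (η * Site.tdist x x'))) :=
    (abs_nonneg _).trans (hGj' x x')
  have h1 := hg x
  have h2 := hGj' x x'
  have h3 := hg' x'
  unfold coeff39
  rw [abs_mul, abs_mul, abs_mul]
  calc |∑ μ : Fin P.d, dKernel η⁻¹ μ Gj x x'| * |g x| * |Gj' x x'| * |g' x'|
      ≤ (P.d * (C₁ * s ^ (-(P.d : ℝ)) * Real.exp (-(δ * s⁻¹ * (η * Site.tdist x x'))))) * 1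
          * (C₂ * s' ^ (2 - (P.d : ℝ)) * Real.exp (-(δ * s'⁻¹ * (η * Site.tdist x x')))) * 1 := by
        gcongr
    _ = _ := by ring

/-- kernel: the pairing with the charge matrix: `|φ(x)·q(qR)| ≤ ‖φ(x)‖·Q²·‖R‖` when `‖qw‖ ≤ Q‖w‖`. [folklore] -/
private theorem abs_inner_qq_le {Q : ℝ} (hQ : 0 ≤ Q) (q : W →ₗ[ℝ] W) (hq : ∀ w : W, ‖q w‖ ≤ Q * ‖w‖) (a R : W) :
    |⟪a, q (q R)⟫| ≤ ‖a‖ * (Q ^ 2 * ‖R‖) := by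
  calc |⟪a, q (q R)⟫| ≤ ‖a‖ * ‖q (q R)‖ := abs_real_inner_le_norm _ _
    _ ≤ ‖a‖ * (Q ^ 2 * ‖R‖) := by
        refine mul_le_mul_of_nonneg_left ?_ (norm_nonneg _)
        calc ‖q (q R)‖ ≤ Q * ‖q R‖ := hq _
          _ ≤ Q * (Q * ‖R‖) := mul_le_mul_of_nonneg_left (hq R) hQ
          _ = Q ^ 2 * ‖R‖ := by ring

/-- **(3.13)/(3.14)** p. 436 [PDF 26], POINTWISE form (before the localization into cubes `Δ(v)`, `Δ(v′)`), PROVED: under the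
(2.10)-type bounds on the two propagator kernels at the scales `s = L^jη`, `s′ = L^{j′}η`, `|g|, |g′| ≤ 1`, `‖qw‖ ≤ Q‖w‖` and the Hölder
hypothesis `‖(∂^η_μφ′)(z) − (∂^η_μφ′)(z′)‖ ≤ H|z − z′|^α` (`0 ≤ α ≤ 1`), the expression (3.12) satisfies
`|(3.12)| ≤ 2dC₁C₂Q²H(2/δ + 8/δ²)·(m·m^α)·Σ_{x,x′}η^{2d}‖φ(x)‖·s^{−d}e^{−½δ|x−x′|/s}·s′^{−d+2}e^{−½δ|x−x′|/s′}`, `m = min(s,s′) = L^{j₁}η` —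
the printed factors `(L^jη)^{−d}e^{−δ₀…}(L^{j′}η)^{−d+2}e^{−δ₀…}(L^{j₁}η)^{1+α}` with the Hölder supremum and `δ₀ = ½δ`; summing `Σ_{x∈Δ(v),
x′∈Δ(v′)}η^{2d} = (L^{j₁}η)^{2d}` and taking suprema over the cubes gives the displayed (3.13). [cite: Balaban1983Higgs3, (3.13) p.436] -/
theorem abs_term312_le (η : ℝ) (hη : 0 < η) {α H Q C₁ C₂ δ s s' : ℝ} (hα0 : 0 ≤ α) (hα1 : α ≤ 1) (hH : 0 ≤ H) (hQ : 0 ≤ Q)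
    (hδ : 0 < δ) (hs : 0 < s) (hs' : 0 < s') (q : W →ₗ[ℝ] W) (hq : ∀ w : W, ‖q w‖ ≤ Q * ‖w‖)
    (Gj Gj' : Kernel P j) (g g' : SiteField P j ℝ) (hg : ∀ x, |g x| ≤ 1) (hg' : ∀ x, |g' x| ≤ 1)
    (hGj : ∀ (μ : Fin P.d) (x x' : Site P j),
      |dKernel η⁻¹ μ Gj x x'| ≤ C₁ * s ^ (-(P.d : ℝ)) * Real.exp (-(δ * s⁻¹ * (η * Site.tdist x x'))))
    (hGj' : ∀ x x' : Site P j,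
      |Gj' x x'| ≤ C₂ * s' ^ (2 - (P.d : ℝ)) * Real.exp (-(δ * s'⁻¹ * (η * Site.tdist x x'))))
    (φ φ' : SiteField P j W) (hφ' : HolderDeriv η⁻¹ α H φ') :
    |term312 η q Gj Gj' g g' φ φ'| ≤
      2 * P.d * C₁ * C₂ * Q ^ 2 * H * (2 / δ + 8 / δ ^ 2) * (min s s' * (min s s') ^ α) *
        ∑ x : Site P j, ∑ x' : Site P j, η ^ (2 * P.d) *
          (‖φ x‖ * (s ^ (-(P.d : ℝ)) * Real.exp (-(δ / 2 * s⁻¹ * (η * Site.tdist x x'))))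
            * (s' ^ (2 - (P.d : ℝ)) * Real.exp (-(δ / 2 * s'⁻¹ * (η * Site.tdist x x'))))) := by
  have hC₁ : 0 ≤ C₁ := by
    have h := (abs_nonneg _).trans (hGj ⟨0, P.hd⟩ default default)
    have hpos : 0 < s ^ (-(P.d : ℝ)) * Real.exp (-(δ * s⁻¹ * (η * Site.tdist (default : Site P j) default))) :=
      mul_pos (Real.rpow_pos_of_pos hs _) (Real.exp_pos _)
    rw [mul_assoc] at h
    exact nonneg_of_mul_nonneg_left h hpos
  have hC₂ : 0 ≤ C₂ := by
    have h := (abs_nonneg _).trans (hGj' default default)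
    have hpos : 0 < s' ^ (2 - (P.d : ℝ)) * Real.exp (-(δ * s'⁻¹ * (η * Site.tdist (default : Site P j) default))) :=
      mul_pos (Real.rpow_pos_of_pos hs' _) (Real.exp_pos _)
    rw [mul_assoc] at h
    exact nonneg_of_mul_nonneg_left h hpos
  -- the constant and the per-pair bound
  set K : ℝ := 2 * P.d * C₁ * C₂ * Q ^ 2 * H * (2 / δ + 8 / δ ^ 2) * (min s s' * (min s s') ^ α) with hK
  have hterm : ∀ x x' : Site P j,
      |η ^ (2 * P.d) * (coeff39 η Gj Gj' g g' x x' * ⟪φ x, q (q (remFwd η⁻¹ φ' x x'))⟫)| ≤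
        K * (η ^ (2 * P.d) * (‖φ x‖ * (s ^ (-(P.d : ℝ)) * Real.exp (-(δ / 2 * s⁻¹ * (η * Site.tdist x x'))))
          * (s' ^ (2 - (P.d : ℝ)) * Real.exp (-(δ / 2 * s'⁻¹ * (η * Site.tdist x x')))))) := by
    intro x x'
    set u : ℝ := η * Site.tdist x x' with hu
    have hu0 : 0 ≤ u := mul_nonneg hη.le (Nat.cast_nonneg _)
    -- the remainder: a differentiation of order 1 + α
    have hR : ‖remFwd η⁻¹ φ' x x'‖ ≤ 2 * H * u * u ^ α := by
      have h := norm_remFwd_le (inv_pos.mpr hη) hα0 hH hφ' x x'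
      rwa [inv_inv] at h
    have hinner : |⟪φ x, q (q (remFwd η⁻¹ φ' x x'))⟫| ≤ ‖φ x‖ * (Q ^ 2 * (2 * H * u * u ^ α)) :=
      (abs_inner_qq_le hQ q hq _ _).trans
        (mul_le_mul_of_nonneg_left (mul_le_mul_of_nonneg_left hR (sq_nonneg _)) (norm_nonneg _))
    have hcoeff := abs_coeff39_le hg hg' hGj hGj' x x'
    have hA : 0 ≤ (P.d : ℝ) * (C₁ * s ^ (-(P.d : ℝ)) * Real.exp (-(δ * s⁻¹ * u))) := by positivity
    have hB : 0 ≤ C₂ * s' ^ (2 - (P.d : ℝ)) * Real.exp (-(δ * s'⁻¹ * u)) := by positivity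
    have hweight := exp_mul_weight_le hδ hs hs' hu0 hα0 hα1
    have hX : 0 ≤ η ^ (2 * P.d) * (P.d * C₁ * s ^ (-(P.d : ℝ)) * (C₂ * s' ^ (2 - (P.d : ℝ))) * (‖φ x‖ * Q ^ 2 * (2 * H))) := by
      positivity
    calc |η ^ (2 * P.d) * (coeff39 η Gj Gj' g g' x x' * ⟪φ x, q (q (remFwd η⁻¹ φ' x x'))⟫)|
        = η ^ (2 * P.d) * (|coeff39 η Gj Gj' g g' x x'| * |⟪φ x, q (q (remFwd η⁻¹ φ' x x'))⟫|) := by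
          rw [abs_mul, abs_mul, abs_of_nonneg (by positivity : (0:ℝ) ≤ η ^ (2 * P.d))]
      _ ≤ η ^ (2 * P.d) * (((P.d * (C₁ * s ^ (-(P.d : ℝ)) * Real.exp (-(δ * s⁻¹ * u)))) *
            (C₂ * s' ^ (2 - (P.d : ℝ)) * Real.exp (-(δ * s'⁻¹ * u)))) * (‖φ x‖ * (Q ^ 2 * (2 * H * u * u ^ α)))) := by
          refine mul_le_mul_of_nonneg_left ?_ (by positivity)
          exact mul_le_mul hcoeff hinner (abs_nonneg _) (mul_nonneg hA hB)
      _ = η ^ (2 * P.d) * (P.d * C₁ * s ^ (-(P.d : ℝ)) * (C₂ * s' ^ (2 - (P.d : ℝ))) * (‖φ x‖ * Q ^ 2 * (2 * H)))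
            * (Real.exp (-(δ * s⁻¹ * u)) * Real.exp (-(δ * s'⁻¹ * u)) * (u * u ^ α)) := by ring
      _ ≤ η ^ (2 * P.d) * (P.d * C₁ * s ^ (-(P.d : ℝ)) * (C₂ * s' ^ (2 - (P.d : ℝ))) * (‖φ x‖ * Q ^ 2 * (2 * H)))
            * ((2 / δ + 8 / δ ^ 2) * (min s s' * (min s s') ^ α) *
              (Real.exp (-(δ / 2 * s⁻¹ * u)) * Real.exp (-(δ / 2 * s'⁻¹ * u)))) :=
          mul_le_mul_of_nonneg_left hweight hX
      _ = K * (η ^ (2 * P.d) * (‖φ x‖ * (s ^ (-(P.d : ℝ)) * Real.exp (-(δ / 2 * s⁻¹ * u)))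
          * (s' ^ (2 - (P.d : ℝ)) * Real.exp (-(δ / 2 * s'⁻¹ * u))))) := by rw [hK]; ring
  -- summation
  unfold term312
  calc |∑ x : Site P j, ∑ x' : Site P j, η ^ (2 * P.d) *
          (coeff39 η Gj Gj' g g' x x' * ⟪φ x, q (q (remFwd η⁻¹ φ' x x'))⟫)|
      ≤ ∑ x : Site P j, |∑ x' : Site P j, η ^ (2 * P.d) *
          (coeff39 η Gj Gj' g g' x x' * ⟪φ x, q (q (remFwd η⁻¹ φ' x x'))⟫)| := Finset.abs_sum_le_sum_abs _ _
    _ ≤ ∑ x : Site P j, ∑ x' : Site P j, |η ^ (2 * P.d) *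
          (coeff39 η Gj Gj' g g' x x' * ⟪φ x, q (q (remFwd η⁻¹ φ' x x'))⟫)| :=
        Finset.sum_le_sum fun x _ => Finset.abs_sum_le_sum_abs _ _
    _ ≤ ∑ x : Site P j, ∑ x' : Site P j, K * (η ^ (2 * P.d) * (‖φ x‖
          * (s ^ (-(P.d : ℝ)) * Real.exp (-(δ / 2 * s⁻¹ * (η * Site.tdist x x'))))
          * (s' ^ (2 - (P.d : ℝ)) * Real.exp (-(δ / 2 * s'⁻¹ * (η * Site.tdist x x')))))) :=
        Finset.sum_le_sum fun x _ => Finset.sum_le_sum fun x' _ => hterm x x'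
    _ = K * ∑ x : Site P j, ∑ x' : Site P j, η ^ (2 * P.d) * (‖φ x‖
          * (s ^ (-(P.d : ℝ)) * Real.exp (-(δ / 2 * s⁻¹ * (η * Site.tdist x x'))))
          * (s' ^ (2 - (P.d : ℝ)) * Real.exp (-(δ / 2 * s'⁻¹ * (η * Site.tdist x x'))))) := by
        rw [Finset.mul_sum]
        exact Finset.sum_congr rfl fun x _ => by rw [Finset.mul_sum]

end Ineq313

end

end Literature.MathematicalPhysics.QuantumFieldTheory.Balaban1983to89.B3Ineq313Pointwise
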